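import Literature.Algebra.Homology.ContCohomologyCrossedHomClass
import Literature.AnabelianGeometry.AbsoluteAnabelian.AbsTopIII.CcnSynchronizationModel
import Literature.AnabelianGeometry.AbsoluteAnabelian.AbsTopIII.GeometricCyclotomeInnerProofs
import Literature.AnabelianGeometry.AbsoluteAnabelian.AbsTopIII.KummerPU
import HarnessLib

/-!
# [AbsTopIII] Thm. 1.9, steps (b)–(c): the synchronizations for several cusps and the
# group-theoretic `P_U` (sub-DAG statements)

Mochizuki, *Topics in Absolute Anabelian Geometry III*, §1, Theorem 1.9 (b), (c), manuscript p. 37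
(lit key `paper:url-5493eb38cbb7`): "(b) One constructs the natural isomorphisms
`I_z ⥲ μ_Ẑ(Π_U) := M_Z` — where [...] `Z` is the canonical compactification of `Y`, the points of
`Z ∖ U` are all rational over the base field `k_Z` of `Z`, `z ∈ (Z ∖ U)(k_Z)` — via the technique of
Proposition 1.4, (ii).  (c) For `U ⊆ Y ⊆ Z` as in (b), one constructs the subgroup
`P_U ⊆ H¹(Π_U, μ_Ẑ(Π_U))` determined by the cuspidal principal divisors via the isomorphisms of (b) and
the characterization of principal divisors given in Proposition 1.6, (ii) [cf. also the decomposition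
groups of (a); Proposition 1.6, (iii)]."

Sub-DAG `plan/L4/SUBDAG-AbsTopIII-Thm19.md`, rows Thm19.b.r5 / Thm19.c.r6 (cell abc-iut, D-0068 (1));
sibling of `Thm19Steps.lean` (step (a)) and `Thm19KummerContainer.lean` (step (d)).  abc-iut-L4-t1
typed (b) for ONE cusp in natural form (`CurveModel.Thm_1_9_b_natural`: THE synchronization
`inertiaSynchronization` of a cyclotome presentation `U_z = Z ∖ {z} ⊆ Z` is bijective — PROVED modulo
"`I_z ≅ Ẑ`" in `CcnSynchronizationBijective.lean`) and recorded that the several-cusps case "reduces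
to it through `U ⊆ Z ∖ {z} ⊆ Z` and Prop. 1.4 (i), a transport `CurveModel` cannot express without a
third curve".  THIS FILE supplies the third curves as interface data and types (c) as printed,
relative to a model (typing policy θ):

* `CurveModel.CuspSyncPresentation h` — for a cofinite open `U ⊆ Z` (`h`), for EVERY cusp `z` of
  `U`: a cyclotome presentation `U ⊆ U_z ⊆ Z` of the model (`U_z = Z ∖ {z}`, abc-iut-L4-t1's
  `IsCyclotomePresentation`) through which `I_z ⊆ Δ_U` is carried isomorphically onto the inertia
  group of `U_z` at `z` (Prop. 1.4 (i)), with a section of `Δ^{c-cn}_{U_z} ↠ Δ_Z` and the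
  bijectivity witness of the differential (Prop. 1.4 (ii); sections EXIST, `nonempty_ccnSection_res`);
  `CuspSyncPresentation.syncAt z : I_z → M_Z` — THE natural synchronization of (b) at `z`;
* `CurveModel.HasCuspidalDegree` — "restricting cohomology classes of `Π_U` to the various `I_x`"
  (Prop. 1.6 (iii)) READ THROUGH (b): the restriction of `η ∈ H¹(Π_U, M_Z)` to `I_z` is the class of
  the homomorphism `i ↦ n · sync_z(i)` (Literature `ContinuousCohomology.crossedHomClass`; `I_z` acts
  trivially on `M_Z`, `cyclotomeModRep_of_mem_geom`) — i.e. `η` has INTEGRAL cuspidal degree `n` at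
  `z` ("the submodule of `⊕_{x ∈ S} ℤ ⊆ ⊕_{x ∈ S} Ẑ`", Prop. 1.6 (iii));
* `IntrinsicKummerModel.PUgt` — the GROUP-THEORETIC `P_U` of Thm. 1.9 (c): classes with integral
  cuspidal degrees forming a principal divisor of `Z` ("determined by the cuspidal principal divisors";
  'principal' in the model's sense `DivisorCurveModel.IsPrincipal`, whose group-theoretic criterion is
  abc-iut-L4-t1's named fact `DivisorCurveModel.Prop_1_6_ii`), and the NAMED statement
  `IntrinsicKummerModel.Thm19c`: `PUgt = PU` (abc-iut-L4-t1's model-relative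
  `P_U := κ_U(Γ(U, 𝒪_U^×)) ⊔ Ker(res_{Δ_U})`, `KummerPU.lean`).

No new Prop FACT (the cited results Prop. 1.4 (i)(ii), 1.6 (ii)(iii) are existing tree declarations;
the new `def … : Prop` are printed intermediate statements of Thm. 1.9 relative to `M`).  HONEST
FRAMING: statements-first; typed ≠ proved; nothing here bears on [IUTchIII] Cor. 3.12.
-/

noncomputable section

open CategoryTheory
open scoped Classical Pointwise

namespace Literature.AnabelianGeometry.AbsoluteAnabelian.AbsTopIII

universe u

/-! ### Step (b) for several cusps: cyclotome presentations `U ⊆ Z ∖ {z} ⊆ Z` as data -/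

namespace CurveModel

variable {M : CurveModel.{u}}

/-- **The presentations behind Thm. 1.9 (b) for several rational cusps** ("the points of `Z ∖ U` are
all rational [...] `z ∈ (Z ∖ U)(k_Z)` — via the technique of Proposition 1.4, (ii)", p. 37), as
INTERFACE DATA over a cofinite open `U ⊆ Z` (`h`) of the model: for every cusp `z` of `U`, a curve
`U_z = Z ∖ {z}` of the model with `U ⊆ U_z ⊆ Z` (cofinite opens composing to `h`), a cusp of `U_z` onto
whose inertia group `I_z ⊆ Δ_U` maps bijectively (Prop. 1.4 (i)), forming a cyclotome presentation of
`Z` (abc-iut-L4-t1's `IsCyclotomePresentation`: `Z` proper, the cusp rational with free procyclic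
inertia generating the cuspidal kernel, Prop. 1.4 (ii) exact), together with a continuous section of
`Δ^{c-cn}_{U_z} ↠ Δ_Z` and the bijectivity witness of the differential (data of THE natural
synchronization `inertiaSynchronization`, which does not depend on the section,
`inertiaSynchronization_eq`); and the point of `Z` filling `z`. [cite: MochizukiAbsTopIII2015, Thm 1.9 (b) p.37] -/
structure CuspSyncPresentation (M : CurveModel.{u}) {U Z : M.Curve} (h : M.IsCofiniteOpen U Z) :
    Type (u + 1) where
  /-- "`Z ∖ {z}`" for each cusp `z` of `U` -/
  Uz : (M.cusps U).Cusp → M.Curve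
  /-- `U ⊆ U_z` is a cofinite open -/
  hU : ∀ z, M.IsCofiniteOpen U (Uz z)
  /-- `U_z ⊆ Z` is a cofinite open -/
  hZ : ∀ z, M.IsCofiniteOpen (Uz z) Z
  /-- `Π_U ↠ Π_{U_z} ↠ Π_Z` is `Π_U ↠ Π_Z` -/
  res_comp : ∀ z, M.res (hU z) ≫ M.res (hZ z) = M.res h
  /-- the cusp `z` of `U_z = Z ∖ {z}` -/
  cusp : ∀ z, (M.cusps (Uz z)).Cusp
  /-- `(U_z ⊆ Z, z)` is a cyclotome presentation (Prop. 1.4 (ii) exact, `I_z ≅ Ẑ`, `z` rational) -/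
  pres : ∀ z, M.IsCyclotomePresentation (hZ z) (cusp z)
  /-- Prop. 1.4 (i): `I_z ⊆ Δ_U` maps into the inertia group of `U_z` at `z` ... -/
  inertia_le : ∀ z, ((M.cusps U).Icusp z).map (M.res (hU z)).arith.toMonoidHom ≤
    (M.cusps (Uz z)).Icusp (cusp z)
  /-- ... bijectively ("each of which is naturally isomorphic to `Ẑ(1)`") -/
  inertia_bijOn : ∀ z, Set.BijOn (M.res (hU z)).arith ((M.cusps U).Icusp z)
    ((M.cusps (Uz z)).Icusp (cusp z))
  /-- a continuous section of `Δ^{c-cn}_{U_z} ↠ Δ_Z` (exists: `nonempty_ccnSection_res`) -/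
  sec : ∀ z, CcnSection (M.res (hZ z))
  /-- the differential of Prop. 1.4 (ii) is bijective (`Prop_1_4_ii_transgression`) -/
  bij : ∀ z, Function.Bijective (ccnTransgression (M.res (hZ z)) ZHatCoeff.{u} (sec z))
  /-- the point of `Z` over the cusp `z` ("`z ∈ (Z ∖ U)(k_Z)`") -/
  pt : (M.cusps U).Cusp → M.Point Z
  /-- its decomposition group is the image of `D_z` (up to conjugacy) -/
  decomp_pt : ∀ z, ∃ g : (M.ext Z).arith,
    ((M.cusps U).Dcusp z).map (M.res h).arith.toMonoidHom = MulAut.conj g • M.decomp Z (pt z)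
  /-- distinct cusps fill distinct points -/
  pt_injective : Function.Injective pt

namespace CuspSyncPresentation

variable {U Z : M.Curve} {h : M.IsCofiniteOpen U Z} (P : M.CuspSyncPresentation h)

/-- Prop. 1.4 (i) transport: `I_z ⊆ Δ_U → I_z ⊆ Δ_{U_z}` along `Π_U ↠ Π_{U_z}`.
[cite: MochizukiAbsTopIII2015, Prop 1.4 (i) p.31] -/
def inertiaTransport (z : (M.cusps U).Cusp) :
    (M.cusps U).Icusp z →* (M.cusps (P.Uz z)).Icusp (P.cusp z) where
  toFun i := ⟨(M.res (P.hU z)).arith i, P.inertia_le z ⟨i, i.2, rfl⟩⟩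
  map_one' := Subtype.ext (map_one _)
  map_mul' _ _ := Subtype.ext (map_mul _ _ _)

/-- **THE natural synchronization `I_z → M_Z = Hom(H²(Δ_Z, Ẑ), Ẑ)` of Thm. 1.9 (b) at the cusp `z`**:
abc-iut-L4-t1's `inertiaSynchronization` of the presentation `(U_z ⊆ Z, z)` precomposed with the
Prop. 1.4 (i) transport `I_z ⊆ Δ_U ⥲ I_z ⊆ Δ_{U_z}`. [cite: MochizukiAbsTopIII2015, Thm 1.9 (b) p.37] -/
def syncAt (z : (M.cusps U).Cusp) :
    Additive ((M.cusps U).Icusp z) →+ CyclotomeMod (M.ext Z) ZHatCoeff.{u} :=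
  (inertiaSynchronization (M.res (P.hZ z)) (P.pres z).isCuspidallyCentral.le_cuspidalKernel (P.sec z)
      (P.bij z)).comp
    (MonoidHom.toAdditive (P.inertiaTransport z))

/-- The divisor of `Z` supported on the filled-in points with multiplicities `D z` ("cuspidal
divisors", Thm. 1.9 (c)). [cite: MochizukiAbsTopIII2015, Thm 1.9 (c) p.37] -/
def cuspidalDivisor (D : (M.cusps U).Cusp → ℤ) : M.Point Z →₀ ℤ :=
  haveI := Fintype.ofFinite (M.cusps U).Cusp
  ∑ z, Finsupp.single (P.pt z) (D z)

end CuspSyncPresentation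

/-! ### Step (c): cuspidal degrees read through the synchronizations -/

/-- The `I_z`-module `M_Z` obtained by restricting the `Π_U`-module `M_Z` (through `Π_U → Π_Z`) to the
cuspidal inertia group `I_z ≤ Π_U` (coefficients of "`η|_{I_z}`", Prop. 1.6 (iii)).
[cite: MochizukiAbsTopIII2015, Prop 1.6 (iii) p.35] -/
abbrev inertiaRep {U Z : M.Curve} (h : M.IsCofiniteOpen U Z) (z : (M.cusps U).Cusp) :
    TopRep.{u} ℤ ((M.cusps U).Icusp z) :=
  TopRep.res (subgroupInclusion ((M.cusps U).Icusp z) : (M.cusps U).Icusp z →* (M.ext U).arith)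
    (TopRep.res ((M.res h).arith : (M.ext U).arith →* (M.ext Z).arith)
      (cyclotomeModTopRep (M.ext Z) ZHatCoeff.{u}))

/-- **Integral cuspidal degree** ("restricting cohomology classes of `Π_U` to the various `I_x` [...]
where we identify `Hom_Ẑ(I_x, M_X)` with `Ẑ` via the isomorphism `I_x ⥲ M_X`", Prop. 1.6 (iii) p. 35;
"the submodule of `⊕ ℤ ⊆ ⊕ Ẑ`"): the class `η ∈ H¹(Π_U, M_Z)` has degree `n ∈ ℤ` at the cusp `z`
when its restriction to `I_z` is the class of the (continuous, `I_z`-invariant — `I_z ⊆ Δ` acts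
trivially) homomorphism `i ↦ n · sync_z(i)` for THE synchronization of (b).
[cite: MochizukiAbsTopIII2015, Thm 1.9 (c) p.37] -/
def HasCuspidalDegree {U Z : M.Curve} {h : M.IsCofiniteOpen U Z} (P : M.CuspSyncPresentation h)
    (η : cyclotomeModH1 (M.res h) ZHatCoeff.{u}) (z : (M.cusps U).Cusp) (n : ℤ) : Prop :=
  ∃ (hc : Continuous fun i : (M.cusps U).Icusp z => n • P.syncAt z (Additive.ofMul i))
    (hf : ∀ x y : (M.cusps U).Icusp z,
      (⟨_, hc⟩ : C((M.cusps U).Icusp z, M.inertiaRep h z)) (x * y) =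
        (⟨_, hc⟩ : C((M.cusps U).Icusp z, M.inertiaRep h z)) x +
          (M.inertiaRep h z).ρ x ((⟨_, hc⟩ : C((M.cusps U).Icusp z, M.inertiaRep h z)) y)),
    cyclotomeModH1Res (M.res h) ZHatCoeff.{u} ((M.cusps U).Icusp z) η =
      ContinuousCohomology.crossedHomClass (M.inertiaRep h z) ⟨_, hc⟩ hf

end CurveModel

/-! ### Step (c): the group-theoretic `P_U` and its comparison with the model-relative `P_U` -/

namespace IntrinsicKummerModel

variable (M : IntrinsicKummerModel.{u})

/-- **`P_U` of Thm. 1.9 (c), GROUP-THEORETIC form** ("the subgroup `P_U ⊆ H¹(Π_U, μ_Ẑ(Π_U))` determined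
by the cuspidal principal divisors via the isomorphisms of (b) and the characterization of principal
divisors given in Proposition 1.6, (ii)", p. 37): the classes `η ∈ H¹(Π_U, M_Z)` admitting INTEGRAL
cuspidal degrees `D : (Z ∖ U) → ℤ` (read through the synchronizations of the presentation `P`) whose
cuspidal divisor `Σ D(z)·[z]` on `Z` is principal ('principal' in the model's sense
`DivisorCurveModel.IsPrincipal`; its group-theoretic criterion is the named fact
`DivisorCurveModel.Prop_1_6_ii`). [cite: MochizukiAbsTopIII2015, Thm 1.9 (c) p.37] -/
def PUgt {U Z : M.Curve} {h : M.IsCofiniteOpen U Z} (P : M.toCurveModel.CuspSyncPresentation h) :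
    Set (cyclotomeModH1 (M.res h) ZHatCoeff.{u}) :=
  {η | ∃ D : (M.cusps U).Cusp → ℤ,
    (∀ z, CurveModel.HasCuspidalDegree P η z (D z)) ∧ M.IsPrincipal (P.cuspidalDivisor D)}

/-- **Thm. 1.9 (c), relative to `M`**: for a cofinite open `U ⊆ Z` of the model with `Z` a proper
scheme-like curve of genus `≥ 2` over a Kummer-faithful field, all cusps of `U` rational, and any system
of cyclotome presentations `P` (step (b)), the group-theoretic `P_U` (integral cuspidal degrees read
through THE synchronizations of (b), forming a principal divisor) coincides with abc-iut-L4-t1's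
model-relative `P_U = κ_U(Γ(U, 𝒪_U^×)) ⊔ Ker(res_{Δ_U})` (`KummerPU.lean`; = "the inverse image of the
submodule [...] determined by the cuspidal principal divisors" given the exact sequence of Prop. 1.6
(iii)).  NAMED statement relative to `M` (junction: `Prop_1_6_ii`, `Prop_1_6_iii_ker`,
`Thm_1_9_b_natural`). [cite: MochizukiAbsTopIII2015, Thm 1.9 (c) p.37] -/
def Thm19c (M : IntrinsicKummerModel.{u}) : Prop :=
  ∀ (U Z : M.Curve) (h : M.IsCofiniteOpen U Z) (hZ : M.IsProper Z), M.IsScheme U → M.IsScheme Z →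
    2 ≤ M.genus Z → IsKummerFaithful (M.base U) → (∀ c : (M.cusps U).Cusp, (M.cusps U).IsRational c) →
      ∀ P : M.toCurveModel.CuspSyncPresentation h, M.PUgt P = (M.PU h hZ : Set _)

end IntrinsicKummerModel

end Literature.AnabelianGeometry.AbsoluteAnabelian.AbsTopIII
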